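import Summits.QuantumFields.BalabanUV.T4Continuum.Support.NE7AllMinimisersHolderRegGeneric
import HarnessLib

/-!
# NE7AllMinimisersHolderRegWindows — the (9)-type letter of ✓ `all_minimisers_holderReg_generic` SERVED AT EVERY WINDOW SCALE AND FOR EVERY GAUGE COPY:
# `HolderReg` is monotone in the spacing `η` (a coarser window `η′ = (L^lvl)⁻¹ ≥ (L^k)⁻¹ = η` asks less) and covariant under unitary gauge transformations (the END's
# backgrounds are gauge copies `U^w` of minimisers, `hO` of the docked END); hence for every minimiser `U` at level `k`, every unitary `w`, every `lvl ≤ k` and every site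
# `z`:  `HolderReg (U^w) z 6 ((L^lvl)⁻¹) (a₀ε) (a₁ε) β (a₂ε)` — the exact per-window shape of the HR tower's (D)-block letters `hA9W∕hB9W` (✓ p812443∕p812547)

Cell `pub-balaban`, rung (B)+1 sub-cell t4, lineage `b2b-balaban-t4-ne7-p1` (CRUX PROVER NE7 #1 = OWNER of BINDER row NE7), generation 111.  Memo
`t4/b2b-balaban-t4-ne7-p1-g111/ROAD-G111.md` §5 (1).  File F6 of the line «(9)-TYPE k-UNIFORM HÖLDER REGULARITY OF EVERY CONSTRAINED SMALL-FIELD MINIMISER, every β < 1».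
WHAT ([folklore]; 0 def, 0 sorry).  §1 (every `d`, every complete normed `ℂ`-algebra) `HolderReg.of_eta_le` (spacing monotonicity), `HolderReg.gaugeAct` (gauge covariance:
`u ↦ w·u`, same potential `B`); §2 (`d = 4`, any `L ≥ 2`, any `U(n)`) **`all_minimisers_holderReg_windows`**.
HONEST FRAMING (page 1): bookkeeping over ✓ p814290; our minimisers, our route; lattice-local; nothing of Bałaban's asserted; the identification of the END's `VA∕VB` with these
gauge copies is the END-instantiator's business; NE3∕NE7 NOT proved as spine nodes; spine 0∕9; FIXED FINITE T⁴ rung (B)+1 — NOT infinite volume, NOT mass gap, NOT BetaPertH,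
NOT Clay (continuum YM on T⁴ ⇐ BetaPertH ∧ nine spine estimates).
-/

set_option autoImplicit false

open scoped BigOperators Matrix Matrix.Norms.L2Operator
open NormedSpace Finset

namespace Summit.QuantumFields.BalabanUV.T4Continuum.NE7AllMinimisersHolderRegWindows

open Literature.MathematicalPhysics.QuantumFieldTheory.Balaban1983to89
open B7Prop1Explicit B7Prop2Explicit
open T4AveragingDeficitWall (IsUnitaryCfg SmallField)
open T4AveragingDeficitWallBoundary (IsPeriodicCfg)
open AveragingDeficitTransport (mem_U1_of_unitary)
open MinimalActionSandwich (IsMinimiser)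
open MinimalActionRate (sfClass)
open B11HolderComplex (HolderOn)
open TermwiseHolder (HolderReg)
open NE7AllMinimisersHolderRegGeneric (all_minimisers_holderReg_generic)

noncomputable section

/-! ## §1 Spacing monotonicity and gauge covariance of `HolderReg` -/

section Generic

variable {d : ℕ} {𝔸 : Type*} [NormedRing 𝔸] [NormOneClass 𝔸] [NormedAlgebra ℂ 𝔸] [CompleteSpace 𝔸]

/-- **`HolderReg` is monotone in the spacing**: for `0 ≤ η ≤ η′`, `0 ≤ β` and non-negative constants, `HolderReg V z R η c₀ c₁ β c₂ → HolderReg V z R η′ c₀ c₁ β c₂` (same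
gauge, same potential; the three bounds grow with `η`, and the Hölder clause at spacing `η′` ranges over FEWER pairs, `η′·l1 ≤ 1 ⟹ η·l1 ≤ 1`). [folklore] -/
theorem HolderReg.of_eta_le {V : Site d → Fin d → 𝔸ˣ} {z : Site d} {R : ℕ} {η η' c₀ c₁ β c₂ : ℝ}
    (h : HolderReg V z R η c₀ c₁ β c₂) (hη : 0 ≤ η) (hηη' : η ≤ η') (hc₀ : 0 ≤ c₀) (hc₁ : 0 ≤ c₁) (hc₂ : 0 ≤ c₂) (hβ : 0 ≤ β) :
    HolderReg V z R η' c₀ c₁ β c₂ := by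
  obtain ⟨u, B, hu, hrep, hB₀, hB₁, hH⟩ := h
  have hη' : 0 ≤ η' := hη.trans hηη'
  have hsq : η ^ 2 ≤ η' ^ 2 := pow_le_pow_left₀ hη hηη' 2
  refine ⟨u, B, hu, hrep, fun x κ hx => (hB₀ x κ hx).trans (mul_le_mul_of_nonneg_right hηη' hc₀),
    fun x κ ι hx => (hB₁ x κ ι hx).trans (mul_le_mul_of_nonneg_right hsq hc₁), ?_⟩
  intro x x' hP
  obtain ⟨hxx, hdist⟩ := hP
  have hl : (0 : ℝ) ≤ (l1 (x' - x) : ℝ) := by positivity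
  have hdist' : η * (l1 (x' - x) : ℝ) ≤ 1 := (mul_le_mul_of_nonneg_right hηη' hl).trans hdist
  refine (hH x x' ⟨hxx, hdist'⟩).trans ?_
  have h1 : (η * (l1 (x' - x) : ℝ)) ^ β ≤ (η' * (l1 (x' - x) : ℝ)) ^ β :=
    Real.rpow_le_rpow (by positivity) (mul_le_mul_of_nonneg_right hηη' hl) hβ
  exact mul_le_mul (mul_le_mul_of_nonneg_right hsq hc₂) h1 (Real.rpow_nonneg (by positivity) β) (by positivity)

/-- **`HolderReg` is gauge covariant**: for a gauge function `w` with values in the unit-ball group `U1`, `HolderReg V z R η c₀ c₁ β c₂ → HolderReg (V^w) z R η c₀ c₁ β c₂`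
(gauge `u ↦ w·u`, the same potential `B`: `(u e^B u⁻¹)^w = (wu) e^B (wu)⁻¹`). [folklore] -/
theorem HolderReg.gaugeAct {V : Site d → Fin d → 𝔸ˣ} {z : Site d} {R : ℕ} {η c₀ c₁ β c₂ : ℝ}
    (h : HolderReg V z R η c₀ c₁ β c₂) {w : Site d → 𝔸ˣ} (hw : ∀ x, w x ∈ U1 𝔸) :
    HolderReg (gaugeAct w V) z R η c₀ c₁ β c₂ := by
  obtain ⟨u, B, hu, hrep, hB₀, hB₁, hH⟩ := h
  refine ⟨fun x => w x * u x, B, fun x => (U1 𝔸).mul_mem (hw x) (hu x), fun x κ hx => ?_, hB₀, hB₁, hH⟩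
  show w x * V x κ * (w (x + e κ))⁻¹ = _
  rw [hrep x κ hx]
  simp only [B7Prop1Explicit.gaugeAct, mul_inv_rev, mul_assoc]

end Generic

/-! ## §2 Every minimiser, every gauge copy, every window scale -/

variable {n : Type} [Fintype n] [DecidableEq n]

/-- **THE (9)-TYPE LETTER OF OUR MINIMISERS AT EVERY WINDOW SCALE AND FOR EVERY GAUGE COPY** (`d = 4`, any `L ≥ 2`, any `U(n)`, every `β ∈ (0,1)`): with the constants and
thresholds of ✓ `all_minimisers_holderReg_generic`, for every datum of the small data, every level `k`, every minimiser `U` at level `k`, every unitary gauge function `w`, every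
`lvl ≤ k` and every site `z`: `HolderReg (U^w) z 6 ((L^lvl)⁻¹) (a₀ε) (a₁ε) β (a₂ε)`. [folklore] -/
theorem all_minimisers_holderReg_windows [Nonempty n] {L : ℕ} (hL : 2 ≤ L) {β : ℝ} (hβ : 0 < β) (hβ1 : β < 1) :
    ∃ a₀ a₁ a₂ : ℝ, 0 ≤ a₀ ∧ 0 ≤ a₁ ∧ 0 ≤ a₂ ∧ ∃ ε₀ : ℝ, 0 < ε₀ ∧ ∀ ε : ℝ, 0 < ε → ε ≤ ε₀ → ∀ (N : ℕ) [NeZero N], 1 ≤ N →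
      ∃ δV : ℝ, 0 < δV ∧
        ∀ V ∈ {V : Site 4 → Fin 4 → (Matrix n n ℂ)ˣ | IsUnitaryCfg V ∧ IsPeriodicCfg V (N : ℤ) ∧ SmallField V δV},
        ∀ (k : ℕ) (U : Site 4 → Fin 4 → (Matrix n n ℂ)ˣ), IsMinimiser 4 (sfClass 4 L N ε) L N k V U →
          ∀ (w : Site 4 → (Matrix n n ℂ)ˣ), (∀ x, w x ∈ unitaryUnits (Matrix n n ℂ)) →
          ∀ lvl : ℕ, lvl ≤ k → ∀ z : Site 4, HolderReg (gaugeAct w U) z 6 (((L : ℝ) ^ lvl)⁻¹) (a₀ * ε) (a₁ * ε) β (a₂ * ε) := by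
  obtain ⟨a₀, a₁, a₂, ha₀, ha₁, ha₂, ε₀, hε₀, H⟩ := all_minimisers_holderReg_generic (n := n) hL hβ hβ1
  refine ⟨a₀, a₁, a₂, ha₀, ha₁, ha₂, ε₀, hε₀, fun ε hε hεle N _ hN => ?_⟩
  obtain ⟨δV, hδV, HV⟩ := H ε hε hεle N hN
  refine ⟨δV, hδV, fun V hV k U hmin w hw lvl hlvl z => ?_⟩
  have hLr : (1 : ℝ) ≤ L := by exact_mod_cast (le_trans (by norm_num) hL)
  have hk : HolderReg U z 6 (((L : ℝ) ^ k)⁻¹) (a₀ * ε) (a₁ * ε) β (a₂ * ε) := HV V hV k U hmin z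
  have hηη' : ((L : ℝ) ^ k)⁻¹ ≤ ((L : ℝ) ^ lvl)⁻¹ :=
    inv_anti₀ (by positivity) (pow_le_pow_right₀ hLr hlvl)
  exact HolderReg.gaugeAct (HolderReg.of_eta_le hk (by positivity) hηη' (by positivity) (by positivity) (by positivity) hβ.le)
    (fun x => mem_U1_of_unitary (hw x))

end

end Summit.QuantumFields.BalabanUV.T4Continuum.NE7AllMinimisersHolderRegWindows
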